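import Summits.QuantumFields.QCD.Theses.ChiralSpinWaves

/-!
# Crux `MassiveBody` (stmt-QuantumFields-16583, route ChiralSpinWaves), negative side 2/2:
# the window package is load-bearing — without it the `∀ reg` statement is junk-false

Refuter vetting file (crux-attack, 2026-08-17), companion of `MassBlind.lean`.  `MassiveBody` is
`∀ Nf ∈ {2,3}, ∀ reg, HasMassScaling → asymptotic scaling → WINDOW → ∀ m > 0, body`.  Deleting WINDOW (the lower
and upper window laws of `ChiralWindow`) leaves "every mass-scaling, asymptotically scaling regularisation realises
massive QCD at every positive tuple", which is false for a junk reason: the canonical regularisation with its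
flavour-blind critical mass PARKED BELOW THE PHYSICAL BRANCH, `m_crit ≡ −3`, has mass scaling and asymptotic
scaling, but its bare trajectory at `m = 1` is `−3 + a_k / Z_m(k) ≤ −2`, so the branch clause
`∀ᶠ k, −1 < m_f(k)` inside `IsQCDAlong` fails for every `(z, shift, T)` (`massiveBody_false_without_window`).
Reading: of the window package only the BRANCH clause of the lower law (`∀ f, ∀ᶠ k, −1 < m_f(k)` for small
tuples, which propagates to all tuples by monotonicity of the bare trajectory in `m`) is visibly load-bearing in
Lean; the load carried by the two GAP laws is physics (they are what `MassBlind.lean` shows NOT to pin `m_crit`).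
Sorry-free; axioms `propext`, `Classical.choice`, `Quot.sound`.
-/

noncomputable section

open Literature.MathematicalPhysics.QuantumFieldTheory Literature.Probability.LatticeModels
open MeasureTheory Filter Topology

namespace Summit.QuantumFields.QCD.Theorems.MassiveBody.Negative

/-- The canonical regularisation's mass renormalisation is at least `1` from step `1` on
(`Z_m(k) = (log (k+1)²)^{4/9} ≥ 1` since `(k+1)² ≥ 4 > e`). [folklore] -/
theorem one_le_canonicalAF_three_Zm {k : ℕ} (hk : k ≠ 0) :
    (1 : ℝ) ≤ (QCDRegularisation.canonicalAF 3).Zm k := by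
  show (1 : ℝ) ≤ (if k = 0 then 1 else Real.log (1 / (QCDScheme.zeroAF 3).a k ^ 2) ^ massExponent 3)
  rw [if_neg hk]
  refine Real.one_le_rpow ?_ (by rw [massExponent_three]; norm_num)
  have hapos : 0 < (QCDScheme.zeroAF 3).a k := (QCDScheme.zeroAF 3).a_pos k
  rw [Real.le_log_iff_exp_le (div_pos one_pos (pow_pos hapos 2))]
  have h4 : (4 : ℝ) ≤ 1 / (QCDScheme.zeroAF 3).a k ^ 2 := by
    show (4 : ℝ) ≤ 1 / (((k : ℝ) + 1)⁻¹) ^ 2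
    rw [inv_pow, one_div, inv_inv]
    have hk1 : (1 : ℝ) ≤ (k : ℝ) := by exact_mod_cast Nat.one_le_iff_ne_zero.2 hk
    nlinarith
  linarith [Real.exp_one_lt_d9]

/-- The canonical regularisation's spacing is at most `1` (`a_k = 1/(k+1)`). [folklore] -/
theorem canonicalAF_three_a_le_one (k : ℕ) : (QCDRegularisation.canonicalAF 3).a k ≤ 1 := by
  show ((k : ℝ) + 1)⁻¹ ≤ 1
  exact inv_le_one_of_one_le₀ (by have := (Nat.cast_nonneg k : (0 : ℝ) ≤ k); linarith)

/-- **`MassiveBody` with the window package deleted is false (junk witness: the critical mass parked below the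
physical branch).**  For `N_f = 3`, the canonical regularisation with `m_crit ≡ −3` has leading-log mass scaling
and two-loop asymptotic scaling, yet at the tuple `m ≡ 1` no `(z, shift, T)` is `IsQCDAlong` its scheme: the
bare trajectory `−3 + a_k/Z_m(k) ≤ −2` never reaches the physical branch `> −1`.  So any proof of `MassiveBody`
uses the window hypothesis — through its branch clause. [folklore] -/
theorem massiveBody_false_without_window :
    ¬ (∀ Nf : ℕ, Nf = 2 ∨ Nf = 3 → ∀ reg : QCDRegularisation Nf, reg.HasMassScaling →
        (reg.scheme 0 0 0).HasAsymptoticScaling → ∀ m : Fin Nf → ℝ, (∀ f, 0 < m f) →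
          ∃ (z shift : QCDField Nf → ℕ → ℝ) (T : OSData (QCDField Nf) 4),
            IsQCDAlong (reg.scheme m z shift) T ∧ T.IsNontrivial QCDField.glue ∧
              T.IsNonGaussian QCDField.glue ∧
                (∀ f g : Fin Nf, f ≠ g → T.IsNontrivial (QCDField.pseudoRe f g)) ∧
                  ∃ Δ > 0, T.HasMassGap Δ ∧ (reg.scheme m z shift).HasLatticeMassGap Δ) := by
  intro h
  have key := h 3 (Or.inr rfl) { QCDRegularisation.canonicalAF 3 with mcrit := fun _ => -3 }
    QCDRegularisation.canonicalAF_hasMassScaling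
    ⟨1, one_pos, by
      show Tendsto (fun k => afBeta 3 1 ((SpeciesScheme.zero Unit).a k) -
        afBeta 3 1 ((SpeciesScheme.zero Unit).a k)) atTop (𝓝 0)
      simp⟩
    (fun _ => 1) (fun _ => one_pos)
  obtain ⟨z, s, T, hQ, -⟩ := key
  obtain ⟨k, hk, hk1⟩ := ((hQ.2.1 0).and (eventually_ge_atTop 1)).exists
  have hk' : (-1 : ℝ) < -3 + (QCDRegularisation.canonicalAF 3).a k * 1 /
      (QCDRegularisation.canonicalAF 3).Zm k := hk
  have hZ := one_le_canonicalAF_three_Zm (k := k) (by omega)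
  have ha := canonicalAF_three_a_le_one k
  have hq : (QCDRegularisation.canonicalAF 3).a k * 1 / (QCDRegularisation.canonicalAF 3).Zm k ≤ 1 := by
    rw [mul_one, div_le_one (by linarith)]
    exact ha.trans hZ
  linarith

end Summit.QuantumFields.QCD.Theorems.MassiveBody.Negative

end
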